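import Mathlib
import HarnessLib.Audit
import Summits.PneNP.PneNP.Theorems.PstarFreshErase

/-!
# A reader violated on the ON-half of a chord is trivial (ROUND-24, O1 at exact tightness; `TerminalPeelable`)

FRONTIER range-avoidance ladder, rung F-N3, ROUND 24 (cell `pnp-ideate`, prover-2 memo `g19/O1-CHORD-READ.md` §3 (the `{x_q = 1}` sub-varieties);
typed target `PstarCoreBoundTargets.TerminalPeelable` (p646951); restricted-model proof complexity — nothing here bears on `P` versus `NP`).

The GENERICITY step of the chord-read lemma on the sub-varieties `Sol(J₀) ∩ {x_q = 1}` (q a private of a chord `c`), obtained from the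
single-query rung `PstarGSat.gSat` by prover-1's lifting trick (`PstarFreshErase.lift`, pattern of `pin_of_freshGate`), with NO Assumption A:

* `gval_liftC_const_of_violated` — if a G-constraint `(C, G)` whose monomials avoid the AND pair of the chord `c` misses its target at EVERY
  solution of the core with `x_q = 1` (`q = vars c 3`), then the lifted constraint `(C″, G)` (`C″ = liftC`, prover-1's substitution
  `q := 1, p := x_a + x_b + y_c`) is a CONSTANT function;
* `eq_empty_of_gval_const` — a constant G-constraint over a pure, simply-overlapping instance has NO monomials and EMPTY linear part;
* `no_monomial_of_violated_on` — hence such a reader has `G = ∅` and `liftC … C = ∅`, i.e. it reads nothing outside the variables of `c`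
  (the instance form of "ĝ ∈ ⟨q+1, Q_c+p⟩" in the memo).

The complementary sub-variety `{x_q = 0}` (the involution side, `PstarChordReads`) is a two-constraint statement and is NOT covered here.
-/

set_option linter.dupNamespace false -- `Summit.PneNP.PneNP.…`: summit = sub-problem name (D-0017 single-conjunct layout)

open Finset Literature.Computability.Complexity
open Summit.PneNP.PneNP.Theorems.PstarFibrePolys (bit bit_injective)
open Summit.PneNP.PneNP.Theorems.PstarTyped (Typed)
open Summit.PneNP.PneNP.Theorems.PstarSALevel (varSet bdry BoundaryExpanding SimpleOverlap)
open Summit.PneNP.PneNP.Theorems.PstarGapPeeling (eval_update_of_not_mem not_mem_varSet_of_private)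
open Summit.PneNP.PneNP.Theorems.PstarCentreFree (vars_mem_varSet)
open Summit.PneNP.PneNP.Theorems.PstarGapOneAll (gval)
open Summit.PneNP.PneNP.Theorems.PstarGConstraint (bit_gval gval_false)
open Summit.PneNP.PneNP.Theorems.PstarChordRepair (IsChord)
open Summit.PneNP.PneNP.Theorems.PstarGSat (gSat)
open Summit.PneNP.PneNP.Theorems.PstarFreshErase (lift lift_p eval_lift bit_gval_lift liftC liftc)

namespace Summit.PneNP.PneNP.Theorems.PstarChordReadsLift

variable {n m : ℕ}

/-- `x + x = 0` in `𝔽₂`. -/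
private theorem zmod2_add_self (x : ZMod 2) : x + x = 0 := by
  revert x; decide

/-- Every element of `𝔽₂` is a `bit`. -/
private theorem exists_bit_eq (s : ZMod 2) : ∃ b : Bool, bit b = s := by
  revert s; decide

/-- **A reader missing its target on the ON-half of a chord lifts to a CONSTANT G-constraint** (GSat + lift, no Assumption A). -/
theorem gval_liftC_const_of_violated {r : ℕ} (I : LocalMap 4 n m) (hI : I.IsPure xorAndPred) (hT : Typed I) (hS : SimpleOverlap I)
    (hB : BoundaryExpanding r I) {y : Fin m → Bool} {J₀ : Finset (Fin m)} (hJr : J₀.card ≤ r) {c : Fin m} (hc : c ∈ J₀) (hch : IsChord I J₀ c)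
    (C : Finset (Fin n)) {G : Finset (Fin m)} (hdj : Disjoint J₀ G)
    (hG : ∀ g ∈ G, (I.vars g 2 ≠ I.vars c 3 ∧ I.vars g 3 ≠ I.vars c 3) ∧ (I.vars g 2 ≠ I.vars c 2 ∧ I.vars g 3 ≠ I.vars c 2)) (b : Bool)
    (hviol : ∀ x : Fin n → Bool, (∀ j ∈ J₀, I.eval x j = y j) → x (I.vars c 3) = true → gval I C G x ≠ b) :
    ∀ x x' : Fin n → Bool,
      gval I (liftC I c (I.vars c 3) (I.vars c 2) C) G x = gval I (liftC I c (I.vars c 3) (I.vars c 2) C) G x' := by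
  classical
  have hpp : (I.vars c 2 = I.vars c 3 ∧ I.vars c 3 = I.vars c 2) ∨ (I.vars c 2 = I.vars c 2 ∧ I.vars c 3 = I.vars c 3) := Or.inr ⟨rfl, rfl⟩
  have hne' : I.vars c 3 ≠ I.vars c 2 := fun h => absurd (hI.2 c h) (by decide)
  -- lifts of solutions of `J₀ ∖ c` solve `J₀`
  have hliftSol : ∀ x₀ : Fin n → Bool, (∀ j ∈ J₀.erase c, I.eval x₀ j = y j) →
      ∀ j ∈ J₀, I.eval (lift I y c (I.vars c 3) (I.vars c 2) x₀) j = y j := by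
    intro x₀ hx₀ j hj
    by_cases hjc : j = c
    · rw [hjc]; exact eval_lift hI hpp hne' y x₀
    · have h3 : I.vars c 3 ∉ varSet I j := not_mem_varSet_of_private I hc hj hjc hch.2 (vars_mem_varSet I c 3)
      have h2 : I.vars c 2 ∉ varSet I j := not_mem_varSet_of_private I hc hj hjc hch.1 (vars_mem_varSet I c 2)
      unfold lift
      rw [eval_update_of_not_mem I j _ h2, eval_update_of_not_mem I j _ h3]
      exact hx₀ j (mem_erase.2 ⟨hjc, hj⟩)
  -- the lifted constraint misses `b₀` on `Sol(J₀ ∖ c)`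
  obtain ⟨b₀, hb₀⟩ := exists_bit_eq (bit b + liftc C (I.vars c 3) (I.vars c 2) y c)
  have hcc := zmod2_add_self (liftc C (I.vars c 3) (I.vars c 2) y c)
  have hmiss : ∀ x₀ : Fin n → Bool, (∀ j ∈ J₀.erase c, I.eval x₀ j = y j) →
      gval I (liftC I c (I.vars c 3) (I.vars c 2) C) G x₀ ≠ b₀ := by
    intro x₀ hx₀ hb
    have hw : gval I C G (lift I y c (I.vars c 3) (I.vars c 2) x₀) = b := by
      apply bit_injective
      rw [bit_gval_lift hI hpp hne' y C hG x₀, hb, hb₀]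
      linear_combination hcc
    exact hviol _ (hliftSol x₀ hx₀) (lift_p hne' y x₀) hw
  -- by `gSat` it is constant
  intro x x'
  by_contra hxx
  have hJr' : (J₀.erase c).card ≤ r := (card_le_card (erase_subset c J₀)).trans hJr
  obtain ⟨x₀, hx₀, hb⟩ := gSat n m r I hI hT hB hS y (J₀.erase c) G (liftC I c (I.vars c 3) (I.vars c 2) C) b₀ hJr'
    (hdj.mono_left (erase_subset c J₀)) ⟨x, x', hxx⟩
  exact hmiss x₀ hx₀ hb

/-- `bit` of a decidable indicator. -/
private theorem bit_decide (P : Prop) [Decidable P] : bit (decide P) = if P then 1 else 0 := by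
  by_cases h : P <;> simp [h, bit]

/-- **A constant G-constraint over a pure, simply-overlapping instance is empty**: no linear read, no monomial. -/
theorem eq_empty_of_gval_const (I : LocalMap 4 n m) (hI : I.IsPure xorAndPred) (hS : SimpleOverlap I) {C : Finset (Fin n)}
    {G : Finset (Fin m)} (h : ∀ x x' : Fin n → Bool, gval I C G x = gval I C G x') : C = ∅ ∧ G = ∅ := by
  classical
  have key : ∀ x : Fin n → Bool, bit (gval I C G x) = 0 := fun x => by
    rw [h x (fun _ => false), gval_false]; rfl
  have h23 : ∀ g : Fin m, I.vars g 2 ≠ I.vars g 3 := fun g hg => absurd (hI.2 g hg) (by decide)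
  -- the linear part is empty: test the indicator of one variable
  have hC : C = ∅ := by
    by_contra hne
    obtain ⟨v, hv⟩ := nonempty_iff_ne_empty.2 hne
    have hk := key (fun w => decide (w = v))
    rw [bit_gval] at hk
    have hlin : ∑ w ∈ C, bit (decide (w = v)) = 1 := by
      rw [sum_congr rfl fun w _ => bit_decide (w = v), sum_ite_eq' C v, if_pos hv]
    have hmono : ∑ g ∈ G, bit (decide (I.vars g 2 = v)) * bit (decide (I.vars g 3 = v)) = 0 := by
      refine sum_eq_zero fun g _ => ?_
      rw [bit_decide, bit_decide]
      by_cases h2 : I.vars g 2 = v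
      · rw [if_pos h2, if_neg (fun h3 => h23 g (h2.trans h3.symm)), mul_zero]
      · rw [if_neg h2, zero_mul]
    rw [hlin, hmono, add_zero] at hk
    exact one_ne_zero hk
  subst hC
  refine ⟨rfl, ?_⟩
  -- the monomial part is empty: test the indicator of one AND pair
  by_contra hne
  obtain ⟨g, hg⟩ := nonempty_iff_ne_empty.2 hne
  let x : Fin n → Bool := fun w => decide (w = I.vars g 2 ∨ w = I.vars g 3)
  have hk := key x
  rw [bit_gval, sum_empty, zero_add] at hk
  have hself : bit (x (I.vars g 2)) * bit (x (I.vars g 3)) = 1 := by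
    simp [x, bit]
  have hother : ∀ g' ∈ G, g' ≠ g → bit (x (I.vars g' 2)) * bit (x (I.vars g' 3)) = 0 := by
    intro g' hg' hgg
    simp only [x, bit_decide]
    by_cases h2 : I.vars g' 2 = I.vars g 2 ∨ I.vars g' 2 = I.vars g 3
    · by_cases h3 : I.vars g' 3 = I.vars g 2 ∨ I.vars g' 3 = I.vars g 3
      · -- `g'` and `g` share the two variables of `g`'s AND pair: excluded by simple overlap
        exfalso
        have hsub : {I.vars g' 2, I.vars g' 3} ⊆ varSet I g' ∩ varSet I g := by
          intro w hw
          rcases mem_insert.1 hw with rfl | hw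
          · refine mem_inter.2 ⟨vars_mem_varSet I g' 2, ?_⟩
            rcases h2 with h | h
            · exact h ▸ vars_mem_varSet I g 2
            · exact h ▸ vars_mem_varSet I g 3
          · rw [mem_singleton] at hw; subst hw
            refine mem_inter.2 ⟨vars_mem_varSet I g' 3, ?_⟩
            rcases h3 with h | h
            · exact h ▸ vars_mem_varSet I g 2
            · exact h ▸ vars_mem_varSet I g 3
        have hcard : ({I.vars g' 2, I.vars g' 3} : Finset (Fin n)).card = 2 := card_pair (h23 g')
        have := (card_le_card hsub).trans (hS g' g hgg)
        omega
      · rw [if_pos h2, if_neg h3, mul_zero]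
    · rw [if_neg h2, zero_mul]
  rw [← sum_erase_add _ _ hg, hself, sum_eq_zero (fun g' hg' => hother g' (mem_of_mem_erase hg') (ne_of_mem_erase hg')), zero_add] at hk
  exact one_ne_zero hk

/-- **Summary.**  In the situation of `gval_liftC_const_of_violated`: the reader has NO monomials and its lifted linear part is empty. -/
theorem no_monomial_of_violated_on {r : ℕ} (I : LocalMap 4 n m) (hI : I.IsPure xorAndPred) (hT : Typed I) (hS : SimpleOverlap I)
    (hB : BoundaryExpanding r I) {y : Fin m → Bool} {J₀ : Finset (Fin m)} (hJr : J₀.card ≤ r) {c : Fin m} (hc : c ∈ J₀) (hch : IsChord I J₀ c)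
    (C : Finset (Fin n)) {G : Finset (Fin m)} (hdj : Disjoint J₀ G)
    (hG : ∀ g ∈ G, (I.vars g 2 ≠ I.vars c 3 ∧ I.vars g 3 ≠ I.vars c 3) ∧ (I.vars g 2 ≠ I.vars c 2 ∧ I.vars g 3 ≠ I.vars c 2)) (b : Bool)
    (hviol : ∀ x : Fin n → Bool, (∀ j ∈ J₀, I.eval x j = y j) → x (I.vars c 3) = true → gval I C G x ≠ b) :
    liftC I c (I.vars c 3) (I.vars c 2) C = ∅ ∧ G = ∅ :=
  eq_empty_of_gval_const I hI hS (gval_liftC_const_of_violated I hI hT hS hB hJr hc hch C hdj hG b hviol)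

end Summit.PneNP.PneNP.Theorems.PstarChordReadsLift
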